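import Mathlib
import HarnessLib

/-!
# Route `ColdStartUniversality` (fixed-cut-off package, `Lᵖ` side): real-variable and integral toolkit for GROSS'S THEOREM
# (log-Sobolev ⇒ hypercontractivity) along a Markov semigroup with a MOVING EXPONENT `q(t) = 1 + (p−1)e^{4ρt}`

Helper file (seat `ym-line-csu-p1`, g36; `--supports stmt-QuantumFields-24809`).  ABSTRACT real analysis / integration, no SZZ object
(namespace `…ColdStartUniversality.LqFlow`, the `Lᵖ` twin of g21's `…EntropyFlowTools`).  Gross's differential inequality
`(d/dt) log ‖κ_tF‖_{q(t)} ≤ 0` is proved in the sequel (`…LatticeLangevinHypercontractivity`) as a DINI inequality from the scale-`h`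
`L^q` production inequality (`…WilsonLqProduction`); the present file isolates the bookkeeping that does not see the kernel:

* `rpow_add_sub_le` — moving the exponent pointwise: `w^{q+ε} − w^q − ε w^q log w ≤ w^q (εΛ)²` for `|log w| ≤ Λ`, `0 ≤ ε`, `εΛ ≤ 1`;
* `integral_rpow_add_le` — integrated: `∫ w^{q+ε} dν ≤ ∫ w^q dν + ε ∫ w^q log w dν + (εΛ)² ∫ w^q dν` (continuous `w > 0` on a compact space);
* `abs_rpow_mul_log_sub_le`, `abs_integral_rpow_mul_log_sub_le` — `x ↦ x^q log x` is Lipschitz on `[δ, B]` (`δ > 0`), hence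
  `|∫ w^q log w dν − ∫ u^q log u dν| ≤ M₁·D·ν(X)` when `|w − u| ≤ D`, both valued in `[δ, B]`;
* `exponent_increment_bounds` — for `ε(h) = (q−1)(e^{4ρh} − 1) = q(t+h) − q(t)`:  `0 ≤ ε − 4(q−1)ρh ≤ 16ρ²(q−1)e^{4ρ}h²` and
  `ε ≤ 4ρ(q−1)e^{4ρ}h` on `0 ≤ h ≤ 1`;
* ★ `div_log_sub_div_log_le` — the slope algebra: if `N' ≤ N + k·N log N + R` (`N, N' > 0`, `R ≥ 0`, `1 ≤ q ≤ q'`) then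
  `log N'/q' − log N/q ≤ |log N|·|qk − (q' − q)| + R/N` — with `qk = 4(q−1)ρh` and `q' − q = ε(h)` the first term is `O(h²)`:
  this is the cancellation `q'(t)·Ent = 4ρ(q−1)·Ent` that makes `t ↦ log ‖κ_tF‖_{q(t)}` non-increasing;
* ★ `gross_slope_lt` — ONE DINI STEP assembled in real arithmetic only: the production bound, the exponent bound, the Lipschitz
  bound, the increment bounds, the choice of `η` and the smallness of `h` give `log N'/(q+ε) − log N/q < r·h`.

THEOREMS ONLY, no definition, no sorry.  HONEST FRAMING: pure bookkeeping for a FIXED-cut-off statement; nothing K-uniform; no crux,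
rung or summit statement is proved; the Yang–Mills mass gap is NOT proved.
-/

set_option autoImplicit false

noncomputable section

namespace Summit.QuantumFields.YangMills.Theorems.ColdStartUniversality.LqFlow

open MeasureTheory Filter Set Topology
open scoped BigOperators NNReal ENNReal

/-! ## §1. Moving the exponent -/

/-- **Moving the exponent, pointwise**: for `0 < w` with `|log w| ≤ Λ`, `0 ≤ ε` and `εΛ ≤ 1`,
`w^{q+ε} − w^q − ε·(w^q log w) ≤ w^q·(εΛ)²` (`w^{q+ε} = w^q e^{ε log w}` and `|e^x − 1 − x| ≤ x²` for `|x| ≤ 1`). [folklore] -/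
theorem rpow_add_sub_le {w q ε Λ : ℝ} (hw : 0 < w) (hΛ : |Real.log w| ≤ Λ) (hε : 0 ≤ ε) (hεΛ : ε * Λ ≤ 1) :
    w ^ (q + ε) - w ^ q - ε * (w ^ q * Real.log w) ≤ w ^ q * (ε * Λ) ^ 2 := by
  have hΛ0 : 0 ≤ Λ := (abs_nonneg _).trans hΛ
  set x : ℝ := ε * Real.log w with hx
  have hxabs : |x| ≤ ε * Λ := by
    rw [hx, abs_mul, abs_of_nonneg hε]
    exact mul_le_mul_of_nonneg_left hΛ hε
  have hx1 : |x| ≤ 1 := hxabs.trans hεΛ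
  have hexp : Real.exp x - 1 - x ≤ (ε * Λ) ^ 2 := by
    have h1 := Real.abs_exp_sub_one_sub_id_le hx1
    have h2 : x ^ 2 ≤ (ε * Λ) ^ 2 := by
      rw [← sq_abs x]
      exact pow_le_pow_left₀ (abs_nonneg _) hxabs 2
    exact (le_abs_self _).trans (h1.trans h2)
  have e1 : w ^ (q + ε) = w ^ q * Real.exp x := by
    rw [Real.rpow_add hw, hx, mul_comm ε (Real.log w), ← Real.rpow_def_of_pos hw]
  have hwq : 0 ≤ w ^ q := (Real.rpow_pos_of_pos hw q).le
  have e2 : w ^ (q + ε) - w ^ q - ε * (w ^ q * Real.log w) = w ^ q * (Real.exp x - 1 - x) := by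
    rw [e1, hx]; ring
  rw [e2]
  exact mul_le_mul_of_nonneg_left hexp hwq

/-- **Moving the exponent under the integral**: for continuous `w > 0` on a compact space, `ν` finite, `|log w| ≤ Λ`, `0 ≤ ε`,
`εΛ ≤ 1`:  `∫ w^{q+ε} dν ≤ ∫ w^q dν + ε·∫ w^q log w dν + (εΛ)²·∫ w^q dν`. [folklore] -/
theorem integral_rpow_add_le {X : Type*} [TopologicalSpace X] [CompactSpace X] [MeasurableSpace X] [OpensMeasurableSpace X]
    (ν : Measure X) [IsFiniteMeasure ν] {w : X → ℝ} (hw : Continuous w) (hpos : ∀ x, 0 < w x)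
    {q ε Λ : ℝ} (hΛ : ∀ x, |Real.log (w x)| ≤ Λ) (hε : 0 ≤ ε) (hεΛ : ε * Λ ≤ 1) :
    ∫ x, w x ^ (q + ε) ∂ν ≤ (∫ x, w x ^ q ∂ν) + ε * (∫ x, w x ^ q * Real.log (w x) ∂ν) + (ε * Λ) ^ 2 * ∫ x, w x ^ q ∂ν := by
  have hc1 : Continuous fun x => w x ^ (q + ε) := hw.rpow_const fun x => Or.inl (hpos x).ne'
  have hc2 : Continuous fun x => w x ^ q := hw.rpow_const fun x => Or.inl (hpos x).ne'
  have hc3 : Continuous fun x => w x ^ q * Real.log (w x) := hc2.mul (hw.log fun x => (hpos x).ne')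
  have bound : ∀ {f : X → ℝ}, Continuous f → Integrable f ν := by
    intro f hf
    obtain ⟨C, hC⟩ := isCompact_univ.exists_bound_of_continuousOn hf.continuousOn
    exact Integrable.of_bound hf.measurable.aestronglyMeasurable C (ae_of_all _ fun x => hC x (mem_univ x))
  have i1 := bound hc1
  have i2 := bound hc2
  have i3 := bound hc3
  have hpt : ∀ x, w x ^ (q + ε) ≤ w x ^ q + ε * (w x ^ q * Real.log (w x)) + (ε * Λ) ^ 2 * w x ^ q := by
    intro x
    have := rpow_add_sub_le (q := q) (hpos x) (hΛ x) hε hεΛ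
    linarith
  have irhs : Integrable (fun x => w x ^ q + ε * (w x ^ q * Real.log (w x)) + (ε * Λ) ^ 2 * w x ^ q) ν :=
    (i2.add (i3.const_mul ε)).add (i2.const_mul _)
  have hm := integral_mono i1 irhs hpt
  have i23 : Integrable (fun x => w x ^ q + ε * (w x ^ q * Real.log (w x))) ν := i2.add (i3.const_mul ε)
  have i4 : Integrable (fun x => (ε * Λ) ^ 2 * w x ^ q) ν := i2.const_mul _
  have i5 : Integrable (fun x => ε * (w x ^ q * Real.log (w x))) ν := i3.const_mul ε
  rw [integral_add i23 i4, integral_add i2 i5, integral_const_mul, integral_const_mul] at hm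
  exact hm

/-! ## §2. `x ↦ x^q log x` is Lipschitz on `[δ, B]` -/

/-- **Pointwise Lipschitz bound**: if `0 < δ`, `a, b ∈ [δ, B]` and `|ξ^{q−1}(q log ξ + 1)| ≤ M₁` on `[δ, B]` (the derivative of
`x ↦ x^q log x`), then `|a^q log a − b^q log b| ≤ M₁|a − b|` (mean value theorem). [folklore] -/
theorem abs_rpow_mul_log_sub_le {q δ B M₁ a b : ℝ} (hδ : 0 < δ)
    (hM₁ : ∀ ξ, δ ≤ ξ → ξ ≤ B → |ξ ^ (q - 1) * (q * Real.log ξ + 1)| ≤ M₁)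
    (ha : δ ≤ a) (haB : a ≤ B) (hb : δ ≤ b) (hbB : b ≤ B) :
    |a ^ q * Real.log a - b ^ q * Real.log b| ≤ M₁ * |a - b| := by
  have hD : Convex ℝ (Icc δ B) := convex_Icc δ B
  have hderiv : ∀ x, 0 < x → HasDerivAt (fun y : ℝ => y ^ q * Real.log y) (x ^ (q - 1) * (q * Real.log x + 1)) x := by
    intro x hx
    have h1 := Real.hasDerivAt_rpow_const (p := q) (Or.inl hx.ne')
    have h2 := Real.hasDerivAt_log hx.ne'
    have h := h1.mul h2
    have hxq : x ^ q = x ^ (q - 1) * x := by rw [← Real.rpow_add_one hx.ne', sub_add_cancel]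
    have e : q * x ^ (q - 1) * Real.log x + x ^ q * x⁻¹ = x ^ (q - 1) * (q * Real.log x + 1) := by
      rw [hxq, mul_inv_cancel_right₀ hx.ne']
      ring
    rw [e] at h
    exact h
  have hdiff : ∀ x ∈ Icc δ B, DifferentiableAt ℝ (fun y : ℝ => y ^ q * Real.log y) x := fun x hx =>
    (hderiv x (lt_of_lt_of_le hδ hx.1)).differentiableAt
  have hbound : ∀ x ∈ Icc δ B, ‖deriv (fun y : ℝ => y ^ q * Real.log y) x‖ ≤ M₁ := by
    intro x hx
    rw [(hderiv x (lt_of_lt_of_le hδ hx.1)).deriv, Real.norm_eq_abs]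
    exact hM₁ x hx.1 hx.2
  have h := hD.norm_image_sub_le_of_norm_deriv_le hdiff hbound ⟨hb, hbB⟩ ⟨ha, haB⟩
  rw [Real.norm_eq_abs, Real.norm_eq_abs] at h
  exact h

/-- **Integrated Lipschitz bound**: continuous `w, u` with values in `[δ, B]` (`δ > 0`) on a compact space, `ν` finite,
`|w − u| ≤ D` and `|ξ^{q−1}(q log ξ + 1)| ≤ M₁` on `[δ, B]`:
`|∫ w^q log w dν − ∫ u^q log u dν| ≤ M₁·D·ν(X)`. [folklore] -/
theorem abs_integral_rpow_mul_log_sub_le {X : Type*} [TopologicalSpace X] [CompactSpace X] [MeasurableSpace X]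
    [OpensMeasurableSpace X] (ν : Measure X) [IsFiniteMeasure ν] {w u : X → ℝ} (hw : Continuous w) (hu : Continuous u)
    {q δ B M₁ D : ℝ} (hδ : 0 < δ) (hδw : ∀ x, δ ≤ w x) (hwB : ∀ x, w x ≤ B) (hδu : ∀ x, δ ≤ u x) (huB : ∀ x, u x ≤ B)
    (hM₁ : ∀ ξ, δ ≤ ξ → ξ ≤ B → |ξ ^ (q - 1) * (q * Real.log ξ + 1)| ≤ M₁) (hD : ∀ x, |w x - u x| ≤ D) :
    |(∫ x, w x ^ q * Real.log (w x) ∂ν) - ∫ x, u x ^ q * Real.log (u x) ∂ν| ≤ M₁ * D * ν.real univ := by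
  have hwpos : ∀ x, 0 < w x := fun x => lt_of_lt_of_le hδ (hδw x)
  have hupos : ∀ x, 0 < u x := fun x => lt_of_lt_of_le hδ (hδu x)
  have hcw : Continuous fun x => w x ^ q * Real.log (w x) :=
    (hw.rpow_const fun x => Or.inl (hwpos x).ne').mul (hw.log fun x => (hwpos x).ne')
  have hcu : Continuous fun x => u x ^ q * Real.log (u x) :=
    (hu.rpow_const fun x => Or.inl (hupos x).ne').mul (hu.log fun x => (hupos x).ne')
  have bound : ∀ {f : X → ℝ}, Continuous f → Integrable f ν := by
    intro f hf
    obtain ⟨C, hC⟩ := isCompact_univ.exists_bound_of_continuousOn hf.continuousOn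
    exact Integrable.of_bound hf.measurable.aestronglyMeasurable C (ae_of_all _ fun x => hC x (mem_univ x))
  rw [← integral_sub (bound hcw) (bound hcu)]
  have hpt : ∀ x, |w x ^ q * Real.log (w x) - u x ^ q * Real.log (u x)| ≤ M₁ * D := fun x =>
    have hM₁0 : 0 ≤ M₁ := (abs_nonneg _).trans (hM₁ (w x) (hδw x) (hwB x))
    (abs_rpow_mul_log_sub_le hδ hM₁ (hδw x) (hwB x) (hδu x) (huB x)).trans (mul_le_mul_of_nonneg_left (hD x) hM₁0)
  have h := norm_integral_le_of_norm_le_const (μ := ν) (f := fun x => w x ^ q * Real.log (w x) - u x ^ q * Real.log (u x))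
    (C := M₁ * D) (Eventually.of_forall fun x => by rw [Real.norm_eq_abs]; exact hpt x)
  rw [Real.norm_eq_abs] at h
  calc _ ≤ M₁ * D * ν.real univ := h
    _ = _ := rfl

/-! ## §3. The moving exponent `q(t) = 1 + (p−1)e^{4ρt}` -/

/-- **Increment bounds for the moving exponent.**  For `ρ ≥ 0`, `q ≥ 1`, `0 ≤ h ≤ 1` and `ε = (q−1)(e^{4ρh} − 1)`
(`= q(t+h) − q(t)` when `q = q(t) = 1 + (p−1)e^{4ρt}`):  `0 ≤ ε − 4(q−1)ρh`,  `ε ≤ 4ρ(q−1)e^{4ρ}·h`,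
`ε − 4(q−1)ρh ≤ 16ρ²(q−1)e^{4ρ}·h²`  (`0 ≤ e^x − 1 − x ≤ x²e^x`, `e^x − 1 ≤ xe^x` for `x ≥ 0`). [folklore] -/
theorem exponent_increment_bounds {ρ q h : ℝ} (hρ : 0 ≤ ρ) (hq : 1 ≤ q) (hh0 : 0 ≤ h) (hh1 : h ≤ 1) :
    0 ≤ (q - 1) * (Real.exp (4 * ρ * h) - 1) - 4 * (q - 1) * ρ * h ∧
      (q - 1) * (Real.exp (4 * ρ * h) - 1) ≤ 4 * ρ * (q - 1) * Real.exp (4 * ρ) * h ∧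
      (q - 1) * (Real.exp (4 * ρ * h) - 1) - 4 * (q - 1) * ρ * h ≤ 16 * ρ ^ 2 * (q - 1) * Real.exp (4 * ρ) * h ^ 2 := by
  set x : ℝ := 4 * ρ * h with hx
  have hx0 : 0 ≤ x := by positivity
  have hx1 : x ≤ 4 * ρ := by rw [hx]; nlinarith
  have hq0 : 0 ≤ q - 1 := by linarith
  have hex : Real.exp x ≤ Real.exp (4 * ρ) := Real.exp_le_exp.2 hx1
  have hexpos : 0 < Real.exp x := Real.exp_pos x
  -- `e^x − 1 ≤ x e^x` (from `1 − x ≤ e^{−x}`)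
  have hA : Real.exp x - 1 ≤ x * Real.exp x := by
    have h1 := Real.add_one_le_exp (-x)
    have h2 : Real.exp (-x) * Real.exp x = 1 := by rw [← Real.exp_add]; simp
    nlinarith [mul_le_mul_of_nonneg_right h1 hexpos.le]
  -- `0 ≤ e^x − 1 − x`
  have hB : 0 ≤ Real.exp x - 1 - x := by linarith [Real.add_one_le_exp x]
  -- `e^x − 1 − x ≤ x (e^x − 1) ≤ x² e^x`
  have hC : Real.exp x - 1 - x ≤ x ^ 2 * Real.exp x := by nlinarith
  refine ⟨?_, ?_, ?_⟩
  · have : (q - 1) * (Real.exp x - 1) - 4 * (q - 1) * ρ * h = (q - 1) * (Real.exp x - 1 - x) := by rw [hx]; ring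
    rw [this]; exact mul_nonneg hq0 hB
  · calc (q - 1) * (Real.exp x - 1) ≤ (q - 1) * (x * Real.exp (4 * ρ)) :=
          mul_le_mul_of_nonneg_left (hA.trans (mul_le_mul_of_nonneg_left hex hx0)) hq0
      _ = 4 * ρ * (q - 1) * Real.exp (4 * ρ) * h := by rw [hx]; ring
  · have e : (q - 1) * (Real.exp x - 1) - 4 * (q - 1) * ρ * h = (q - 1) * (Real.exp x - 1 - x) := by rw [hx]; ring
    rw [e]
    calc (q - 1) * (Real.exp x - 1 - x) ≤ (q - 1) * (x ^ 2 * Real.exp (4 * ρ)) :=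
          mul_le_mul_of_nonneg_left (hC.trans (mul_le_mul_of_nonneg_left hex (sq_nonneg x))) hq0
      _ = 16 * ρ ^ 2 * (q - 1) * Real.exp (4 * ρ) * h ^ 2 := by rw [hx]; ring

/-! ## §4. The slope algebra -/

/-- ★ **Slope algebra of Gross's argument.**  Let `N, N' > 0`, `1 ≤ q ≤ q'`, `R ≥ 0` and `N' ≤ N + k·(N log N) + R`.  Then
`log N'/q' − log N/q ≤ |log N|·|q·k − (q' − q)| + R/N`
(`log` is increasing and `log(1 + y) ≤ y`; then `(L + kL + R/N)/q' − L/q = L(qk − (q'−q))/(qq') + R/(Nq')`).  In Gross's theorem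
`qk = 4(q−1)ρh` and `q' − q = (q−1)(e^{4ρh} − 1)`, so the first term is `O(h²)`. [folklore] -/
theorem div_log_sub_div_log_le {N N' q q' k R : ℝ} (hN : 0 < N) (hN' : 0 < N') (hq : 1 ≤ q) (hqq' : q ≤ q') (hR : 0 ≤ R)
    (hle : N' ≤ N + k * (N * Real.log N) + R) :
    Real.log N' / q' - Real.log N / q ≤ |Real.log N| * |q * k - (q' - q)| + R / N := by
  set L : ℝ := Real.log N with hL
  have hq0 : 0 < q := by linarith
  have hq'0 : 0 < q' := by linarith
  -- `log N' ≤ L + kL + R/N`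
  have hpos : 0 < N + k * (N * L) + R := lt_of_lt_of_le hN' hle
  have eY : 1 + k * L + R / N = (N + k * (N * L) + R) / N := by field_simp
  have hY : 0 < 1 + k * L + R / N := by rw [eY]; exact div_pos hpos hN
  have eNY : N + k * (N * L) + R = N * (1 + k * L + R / N) := by rw [eY]; field_simp
  have hL' : Real.log N' ≤ L + k * L + R / N := by
    have h1 : Real.log N' ≤ Real.log (N + k * (N * L) + R) := Real.log_le_log hN' hle
    have h2 : Real.log (N + k * (N * L) + R) = L + Real.log (1 + k * L + R / N) := by
      rw [eNY, Real.log_mul hN.ne' hY.ne']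
    have h3 : Real.log (1 + k * L + R / N) ≤ (1 + k * L + R / N) - 1 := Real.log_le_sub_one_of_pos hY
    linarith
  have hdiv : Real.log N' / q' ≤ (L + k * L + R / N) / q' := div_le_div_of_nonneg_right hL' hq'0.le
  have e2 : (L + k * L + R / N) / q' - L / q = L * (q * k - (q' - q)) / (q * q') + R / (N * q') := by
    field_simp
    ring
  -- the two pieces
  have hqq : 1 ≤ q * q' := one_le_mul_of_one_le_of_one_le hq (hq.trans hqq')
  have hA : L * (q * k - (q' - q)) / (q * q') ≤ |L| * |q * k - (q' - q)| := by
    calc L * (q * k - (q' - q)) / (q * q') ≤ |L * (q * k - (q' - q))| / (q * q') :=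
          div_le_div_of_nonneg_right (le_abs_self _) (by positivity)
      _ ≤ |L * (q * k - (q' - q))| := div_le_self (abs_nonneg _) hqq
      _ = |L| * |q * k - (q' - q)| := abs_mul _ _
  have hB : R / (N * q') ≤ R / N :=
    div_le_div_of_nonneg_left hR hN (le_mul_of_one_le_right hN.le (hq.trans hqq'))
  calc Real.log N' / q' - Real.log N / q ≤ (L + k * L + R / N) / q' - L / q := by rw [← hL]; linarith
    _ = L * (q * k - (q' - q)) / (q * q') + R / (N * q') := e2
    _ ≤ |L| * |q * k - (q' - q)| + R / N := add_le_add hA hB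

/-! ## §5. Assembly of one Dini step (pure real arithmetic) -/

/-- ★ **One Dini step of Gross's argument, real arithmetic only.**  At a time `t` put `q = q(t) ≥ 1`, `N = ‖u‖_q^q > 0`,
`L = log N`, `X = ∫ u^q log u`, `E = Ent(u^q) = qX − NL ≥ 0`; after a lattice step `h > 0` put `ε = q(t+h) − q(t) ≥ 0`,
`N_w = ∫ (κ_hu)^q`, `X_w = ∫ (κ_hu)^q log κ_hu`, `N' = ∫ (κ_hu)^{q+ε} > 0`.  Assume the PRODUCTION bound
`N_w ≤ N − (4(q−1)/q)·h·(ρ−η)·E + A h²`, the EXPONENT bound `N' ≤ N_w + εX_w + (εΛ)²B_q`, the Lipschitz bound `|X_w − X| ≤ M₁Ch`,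
the increment bounds `4(q−1)ρh ≤ ε ≤ E₁h`, `ε − 4(q−1)ρh ≤ E₂h²`, the choice `(4(q−1)/q)·ηE/N ≤ r/2` and the smallness
`h·(2K + 1) < r` with `K = |L|E₂ + (A + E₂|X| + E₁M₁C + E₁²Λ²B_q)/N`.  Then `log N'/(q+ε) − log N/q < r·h`. [folklore] -/
theorem gross_slope_lt {N N' Nw X Xw E L q ε h ρ η A M₁C Λ Bq E₁ E₂ r K : ℝ}
    (hN : 0 < N) (hN' : 0 < N') (hq : 1 ≤ q) (hh : 0 < h) (hρ : 0 ≤ ρ) (hη : 0 ≤ η) (hA : 0 ≤ A) (hM₁C : 0 ≤ M₁C)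
    (hBq : 0 ≤ Bq) (hE0 : 0 ≤ E) (hL : L = Real.log N) (hE : E = q * X - N * L)
    (hP : Nw ≤ N - 4 * (q - 1) / q * h * (ρ - η) * E + A * h ^ 2)
    (hXch : N' ≤ Nw + ε * Xw + (ε * Λ) ^ 2 * Bq) (hLip : |Xw - X| ≤ M₁C * h)
    (hεlo : 4 * (q - 1) * ρ * h ≤ ε) (hεhi : ε ≤ E₁ * h) (hε2 : ε - 4 * (q - 1) * ρ * h ≤ E₂ * h ^ 2)
    (hηr : 4 * (q - 1) / q * η * E / N ≤ r / 2)
    (hK : K = |L| * E₂ + (A + E₂ * |X| + E₁ * M₁C + E₁ ^ 2 * Λ ^ 2 * Bq) / N) (hhK : h * (2 * K + 1) < r) :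
    Real.log N' / (q + ε) - Real.log N / q < r * h := by
  have hq0 : 0 < q := by linarith
  have hqne : q ≠ 0 := hq0.ne'
  have hh2 : 0 < h ^ 2 := by positivity
  have hd0 : 0 ≤ ε - 4 * (q - 1) * ρ * h := by linarith
  have h4q : 0 ≤ 4 * (q - 1) * ρ * h := by
    have : 0 ≤ q - 1 := by linarith
    positivity
  have hε0 : 0 ≤ ε := h4q.trans hεlo
  have hc0 : 0 ≤ 4 * (q - 1) / q := div_nonneg (by linarith) hq0.le
  have hE₁ : 0 ≤ E₁ := le_of_mul_le_mul_right (by rw [zero_mul]; exact hε0.trans hεhi) hh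
  have hE₂ : 0 ≤ E₂ := le_of_mul_le_mul_right (by rw [zero_mul]; exact hd0.trans hε2) hh2
  -- `N' ≤ N + k·(N L) + R'`
  set k : ℝ := 4 * (q - 1) * ρ * h / q with hk
  set R' : ℝ := h * (4 * (q - 1) / q * η * E) + A * h ^ 2 + (ε - 4 * (q - 1) * ρ * h) * |X| + ε * (M₁C * h) +
    (ε * Λ) ^ 2 * Bq with hR'
  have hcηE : 0 ≤ 4 * (q - 1) / q * η * E := mul_nonneg (mul_nonneg hc0 hη) hE0
  have hR'0 : 0 ≤ R' := by
    have h1 : 0 ≤ h * (4 * (q - 1) / q * η * E) := mul_nonneg hh.le hcηE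
    have h2 : 0 ≤ A * h ^ 2 := mul_nonneg hA hh2.le
    have h3 : 0 ≤ (ε - 4 * (q - 1) * ρ * h) * |X| := mul_nonneg hd0 (abs_nonneg _)
    have h4 : 0 ≤ ε * (M₁C * h) := mul_nonneg hε0 (mul_nonneg hM₁C hh.le)
    have h5 : 0 ≤ (ε * Λ) ^ 2 * Bq := mul_nonneg (sq_nonneg _) hBq
    linarith
  have hεX : ε * Xw ≤ ε * X + ε * (M₁C * h) := by
    have h1 : Xw ≤ X + M₁C * h := by linarith [(abs_le.1 hLip).2]
    have := mul_le_mul_of_nonneg_left h1 hε0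
    linarith
  have hkey : ε * X - 4 * (q - 1) / q * h * ρ * E ≤ (ε - 4 * (q - 1) * ρ * h) * |X| + k * (N * L) := by
    have e : ε * X - 4 * (q - 1) / q * h * ρ * E = (ε - 4 * (q - 1) * ρ * h) * X + k * (N * L) := by
      rw [hE, hk]
      field_simp
      ring
    rw [e]
    have : (ε - 4 * (q - 1) * ρ * h) * X ≤ (ε - 4 * (q - 1) * ρ * h) * |X| :=
      mul_le_mul_of_nonneg_left (le_abs_self X) hd0
    linarith
  have hle : N' ≤ N + k * (N * L) + R' := by
    have e : N - 4 * (q - 1) / q * h * (ρ - η) * E =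
        N + (ε * X - 4 * (q - 1) / q * h * ρ * E) + h * (4 * (q - 1) / q * η * E) - ε * X := by ring
    rw [e] at hP
    rw [hR']
    linarith
  -- the slope algebra
  have hslope := div_log_sub_div_log_le (q' := q + ε) (k := k) hN hN' hq (by linarith) hR'0 (by rw [← hL]; exact hle)
  rw [← hL] at hslope
  have e1 : |q * k - (q + ε - q)| = ε - 4 * (q - 1) * ρ * h := by
    have e : q * k = 4 * (q - 1) * ρ * h := by rw [hk]; field_simp
    rw [e, show 4 * (q - 1) * ρ * h - (q + ε - q) = -(ε - 4 * (q - 1) * ρ * h) by ring, abs_neg, abs_of_nonneg hd0]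
  rw [e1] at hslope
  -- bound the two pieces by `h·(r/2) + h²·K`
  have hpiece1 : |L| * (ε - 4 * (q - 1) * ρ * h) ≤ h ^ 2 * (|L| * E₂) := by
    have := mul_le_mul_of_nonneg_left hε2 (abs_nonneg L)
    linarith
  have hR'le : R' ≤ h * (4 * (q - 1) / q * η * E) + h ^ 2 * (A + E₂ * |X| + E₁ * M₁C + E₁ ^ 2 * Λ ^ 2 * Bq) := by
    have h3 : (ε - 4 * (q - 1) * ρ * h) * |X| ≤ E₂ * h ^ 2 * |X| := mul_le_mul_of_nonneg_right hε2 (abs_nonneg X)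
    have h4 : ε * (M₁C * h) ≤ E₁ * h * (M₁C * h) := mul_le_mul_of_nonneg_right hεhi (mul_nonneg hM₁C hh.le)
    have h5 : (ε * Λ) ^ 2 * Bq ≤ (E₁ * h * Λ) ^ 2 * Bq := by
      have : (ε * Λ) ^ 2 ≤ (E₁ * h * Λ) ^ 2 := by
        rw [mul_pow, mul_pow (E₁ * h)]
        exact mul_le_mul_of_nonneg_right (pow_le_pow_left₀ hε0 hεhi 2) (sq_nonneg Λ)
      exact mul_le_mul_of_nonneg_right this hBq
    have e3 : E₂ * h ^ 2 * |X| = h ^ 2 * (E₂ * |X|) := by ring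
    have e4 : E₁ * h * (M₁C * h) = h ^ 2 * (E₁ * M₁C) := by ring
    have e5 : (E₁ * h * Λ) ^ 2 * Bq = h ^ 2 * (E₁ ^ 2 * Λ ^ 2 * Bq) := by ring
    rw [e3] at h3
    rw [e4] at h4
    rw [e5] at h5
    rw [hR']
    linarith
  have hpiece2 : R' / N ≤ h * (r / 2) + h ^ 2 * ((A + E₂ * |X| + E₁ * M₁C + E₁ ^ 2 * Λ ^ 2 * Bq) / N) := by
    have hdiv := div_le_div_of_nonneg_right hR'le hN.le
    have e : (h * (4 * (q - 1) / q * η * E) + h ^ 2 * (A + E₂ * |X| + E₁ * M₁C + E₁ ^ 2 * Λ ^ 2 * Bq)) / N =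
        h * (4 * (q - 1) / q * η * E / N) + h ^ 2 * ((A + E₂ * |X| + E₁ * M₁C + E₁ ^ 2 * Λ ^ 2 * Bq) / N) := by
      simp only [add_div, mul_div_assoc]
    rw [e] at hdiv
    have : h * (4 * (q - 1) / q * η * E / N) ≤ h * (r / 2) := mul_le_mul_of_nonneg_left hηr hh.le
    linarith
  have hK0 : 0 ≤ K := by
    have h1 : 0 ≤ (A + E₂ * |X| + E₁ * M₁C + E₁ ^ 2 * Λ ^ 2 * Bq) / N := by
      apply div_nonneg _ hN.le
      have : 0 ≤ E₂ * |X| := mul_nonneg hE₂ (abs_nonneg X)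
      have : 0 ≤ E₁ * M₁C := mul_nonneg hE₁ hM₁C
      have : 0 ≤ E₁ ^ 2 * Λ ^ 2 * Bq := mul_nonneg (mul_nonneg (sq_nonneg _) (sq_nonneg _)) hBq
      linarith
    have h2 : 0 ≤ |L| * E₂ := mul_nonneg (abs_nonneg L) hE₂
    rw [hK]; linarith
  have htot : Real.log N' / (q + ε) - L / q ≤ h * (r / 2) + h ^ 2 * K := by
    have e : h ^ 2 * K = h ^ 2 * (|L| * E₂) + h ^ 2 * ((A + E₂ * |X| + E₁ * M₁C + E₁ ^ 2 * Λ ^ 2 * Bq) / N) := by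
      rw [hK]; ring
    rw [e]
    linarith [hslope, hpiece1, hpiece2]
  -- `h² K < h r/2` from `h (2K+1) < r`
  have hfin : h ^ 2 * K < h * (r / 2) := by
    have e2 : h * (2 * K + 1) = 2 * (h * K) + h := by ring
    have h1 : h * K < r / 2 := by rw [e2] at hhK; linarith
    have h2 := mul_lt_mul_of_pos_left h1 hh
    have e3 : h ^ 2 * K = h * (h * K) := by ring
    rw [e3]; exact h2
  have hL' : Real.log N = L := hL.symm
  simp only [hL'] at htot ⊢
  linarith

end Summit.QuantumFields.YangMills.Theorems.ColdStartUniversality.LqFlow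

end
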